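import Summits.BirchSwinnertonDyer.Rank1Residual.Additive.KatoDescentKatoRigidOfAugmentation
import Literature.NumberTheory.EllipticCurves.Kato2004.IwasawaH1LambdaTorsionFreeProofs
import Literature.NumberTheory.EllipticCurves.IwasawaAlgebraCharIdealProofs
import Literature.NumberTheory.EllipticCurves.IwasawaAlgebraProofs
import Mathlib.RingTheory.UniqueFactorizationDomain.Multiplicity
import HarnessLib

set_option linter.dupNamespace false
set_option autoImplicit false

/-!
# Route `InertBadSignedBranches` (rung K8), crux 19223 `CccOneLawOnTypeIstarZero`, line `kato_perrin_riou_istar`: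
# the COLLINEARITY `μ`-dictionary of research stub 2b's residual «ZC-μ» (helper `--supports stmt-BirchSwinnertonDyer-19223`)

HONEST FRAMING (refill hand `leafhand-bsd-inertbadsignedbran-4`, LAND-ONLY): BSD is NOT proved by any of this; nothing
here closes a stub, an item or a cell; no definition, no new fact, no `sorry`; nothing is booked.

WHAT.  Hand -3's helpers (`…CccOneLawOnTypeIstarZeroMuDictionaryEta[Keying]`) reduced RESEARCH stub 2b
`KatoPerrinRiouIstar.stub_katoMuEqualityIstarZero` (skeleton v10), granted the line's other named inputs, to EXACTLY «ZC-μ»: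
`length_(p) (𝐇¹_Γ ⧸ Λ∙z₀) = length_(p) (𝐇¹_Γ ⧸ Λ∙z)` for every admissible `z₀` (`Kato2004.IsAdmissibleZetaClass`) and
Kobayashi's `η`-class `z`, both in the SAME pinned `I.H = 𝐇¹_Γ(T_pW)` (`Kato2004.IwasawaH1Data`) — torsion-free over `Λ`
(tree theorem `IwasawaH1Data.isTorsionFree`) and of `Λ`-rank one on the rows, so any two elements are COLLINEAR,
`F • z₀ = G • z` (`PerrinRiouUnit.exists_primitive_collinear`).  This file makes the `μ`-bookkeeping along a collinearity kernel:
* §1 (any commutative ring): along `a • z₀ = b • z` between elements with trivial annihilator,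
  `length_𝔭 (R/(a)) + length_𝔭 (H/R∙z₀) = length_𝔭 (R/(b)) + length_𝔭 (H/R∙z)` at EVERY prime (in `ℕ∞`); unit case; cancellation.
* §2 (`Λ = ℤ_p⟦T⟧` at `(p)`): every `F ≠ 0` is `C(p)^m · F′`, `F′ ∉ (p)`, and `length_(p) (Λ/(F)) = m` (finite).
* §3 (`I : Kato2004.IwasawaH1Data W p K γ`): for non-zero `z₀, z` with `(C(p)^m F′) • z₀ = (C(p)^n G′) • z`, `F′, G′ ∉ (p)`:
  `m + length_(p) (I.H ⧸ Λ∙z₀) = n + length_(p) (I.H ⧸ Λ∙z)`; so «ZC-μ at `(z₀, z)`» ⟺ `m = n` when the right length is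
  finite; under `rank_Λ I.H = 1` such a reading exists for every pair of non-zero elements.
* the companion file `…CollinearMuAdmissible` instantiates §3 in stub 2b's binders (admissible `z₀ ≠ 0` by Rohrlich, rank
  one from Mordell–Weil rank one + `Ш[p^∞]` finite, finiteness, `Λˣ`-independence of the admissible side).
So the residual of stub 2b is ONE integer equality `m = n` read off any collinearity between an admissible class and
Kobayashi's class — NOT asserted here (print ingredients: Kato Thm. 12.5 (1) vs Kobayashi Thm. 6.3 at `η`, Pal's
twist-period unit, Gauss sums; hand -3's census).

References: [Washington1997] §13.2; [Kato2004Asterisque] Thm. 12.4 (2), Thm. 12.5 (1) (p. 221), Conj. 12.10 (p. 224),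
§13.9 (p. 230); [BurungaleTian2026] Rem. 2.7 (p. 5); [Kobayashi2003] Thm. 6.3, proof of Thm. 7.4 (p. 13);
[RohrlichInventiones1984] Theorem (p. 409).
-/

noncomputable section

open scoped Classical

open Field Literature.NumberTheory.EllipticCurves Literature.NumberTheory.EllipticCurves.Module
  Literature.NumberTheory.EllipticCurves.IwasawaAlgebra Literature.NumberTheory.EllipticCurves.Kato2004

namespace Summit.BirchSwinnertonDyer.BirchSwinnertonDyer.Theorems.CccOneCollinearMu

/-! ## §1 Collinearity bookkeeping for local lengths (any commutative ring) -/

section Generic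

variable {R : Type*} [CommRing R] {H : Type*} [AddCommGroup H] [Module R H]

/-- **`length_𝔭 (H ⧸ R∙(a•z)) = length_𝔭 (R ⧸ (a)) + length_𝔭 (H ⧸ R∙z)`** for an element `z` with trivial annihilator
and any `a : R`, at every prime `𝔭`: the sequence `0 → R/(a) →(r ↦ r•z) H/R∙(a•z) → H/R∙z → 0` is exact.
[cite: Washington1997, §13.2] -/
theorem lengthAt_quotient_span_smul_eq_add {z : H} (hz : ∀ r : R, r • z = 0 → r = 0) (a : R)
    (𝔭 : PrimeSpectrum R) :
    lengthAt R (H ⧸ R ∙ (a • z)) 𝔭 =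
      lengthAt R (R ⧸ Ideal.span {a}) 𝔭 + lengthAt R (H ⧸ R ∙ z) 𝔭 := by
  set N : Submodule R H := R ∙ (a • z) with hN
  set M : Submodule R H := R ∙ z with hM
  have hle : N ≤ M := by
    rw [hN, Submodule.span_singleton_le_iff_mem]
    exact Submodule.smul_mem _ a (Submodule.mem_span_singleton_self z)
  let φ : R →ₗ[R] H ⧸ N := N.mkQ ∘ₗ LinearMap.toSpanSingleton R H z
  have hφ : ∀ r : R, φ r = Submodule.Quotient.mk (r • z) := fun r => rfl
  have hker : LinearMap.ker φ = Ideal.span {a} := by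
    ext r
    rw [LinearMap.mem_ker, hφ, Submodule.Quotient.mk_eq_zero, hN, Submodule.mem_span_singleton,
      Ideal.mem_span_singleton']
    constructor
    · rintro ⟨s, hs⟩
      refine ⟨s, ?_⟩
      have h0 : (s * a - r) • z = 0 := by rw [sub_smul, mul_smul, hs, sub_self]
      exact sub_eq_zero.mp (hz _ h0)
    · rintro ⟨s, rfl⟩
      exact ⟨s, by rw [mul_smul]⟩
  let f : (R ⧸ LinearMap.ker φ) →ₗ[R] H ⧸ N := (LinearMap.ker φ).liftQ φ le_rfl
  have hf : Function.Injective f := by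
    rw [← LinearMap.ker_eq_bot]
    exact Submodule.ker_liftQ_eq_bot _ _ _ le_rfl
  let g : (H ⧸ N) →ₗ[R] H ⧸ M := Submodule.factor hle
  have hg : Function.Surjective g := by
    intro y
    obtain ⟨x, rfl⟩ := Submodule.Quotient.mk_surjective M y
    exact ⟨Submodule.Quotient.mk x, rfl⟩
  have hfg : Function.Exact f g := by
    intro y
    obtain ⟨x, rfl⟩ := Submodule.Quotient.mk_surjective N y
    constructor
    · intro hy
      have hy' : (Submodule.Quotient.mk x : H ⧸ M) = 0 := hy
      rw [Submodule.Quotient.mk_eq_zero, hM, Submodule.mem_span_singleton] at hy'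
      obtain ⟨r, rfl⟩ := hy'
      exact ⟨Submodule.Quotient.mk r, rfl⟩
    · rintro ⟨w, hw⟩
      obtain ⟨r, rfl⟩ := Submodule.Quotient.mk_surjective _ w
      have hw' : (Submodule.Quotient.mk (r • z) : H ⧸ N) = Submodule.Quotient.mk x := hw
      change g (Submodule.Quotient.mk x) = 0
      rw [← hw']
      change (Submodule.Quotient.mk (r • z) : H ⧸ M) = 0
      rw [Submodule.Quotient.mk_eq_zero, hM]
      exact Submodule.smul_mem _ r (Submodule.mem_span_singleton_self z)
  rw [lengthAt_eq_add_of_exact f g hf hg hfg 𝔭,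
    lengthAt_eq_of_linearEquiv (Submodule.quotEquivOfEq _ _ hker) 𝔭]

/-- **The collinearity identity**: along `a • z₀ = b • z` between elements with trivial annihilator,
`length_𝔭 (R ⧸ (a)) + length_𝔭 (H ⧸ R∙z₀) = length_𝔭 (R ⧸ (b)) + length_𝔭 (H ⧸ R∙z)` at every prime `𝔭`
(in `ℕ∞`; both sides are `length_𝔭 (H ⧸ R∙(a•z₀))`). [cite: Washington1997, §13.2] -/
theorem lengthAt_add_eq_of_smul_eq_smul {z₀ z : H} (hz₀ : ∀ r : R, r • z₀ = 0 → r = 0)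
    (hz : ∀ r : R, r • z = 0 → r = 0) {a b : R} (h : a • z₀ = b • z) (𝔭 : PrimeSpectrum R) :
    lengthAt R (R ⧸ Ideal.span {a}) 𝔭 + lengthAt R (H ⧸ R ∙ z₀) 𝔭 =
      lengthAt R (R ⧸ Ideal.span {b}) 𝔭 + lengthAt R (H ⧸ R ∙ z) 𝔭 := by
  rw [← lengthAt_quotient_span_smul_eq_add hz₀ a 𝔭, ← lengthAt_quotient_span_smul_eq_add hz b 𝔭, h]

/-- The unit case: `z₀ = u • z` for a unit `u` gives `R∙z₀ = R∙z`. [folklore] -/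
theorem span_singleton_eq_of_eq_units_smul {z₀ z : H} {u : Rˣ} (h : z₀ = (u : R) • z) :
    (R ∙ z₀) = R ∙ z := by
  rw [h]
  exact Submodule.span_singleton_smul_eq u.isUnit z

/-- **The unit case of ZC**: `z₀ = u • z`, `u ∈ Rˣ` ⟹ `length_𝔭 (H ⧸ R∙z₀) = length_𝔭 (H ⧸ R∙z)` at EVERY prime
(no annihilator or finiteness hypothesis). [cite: Washington1997, §13.2] -/
theorem lengthAt_quotient_span_eq_of_eq_units_smul {z₀ z : H} {u : Rˣ} (h : z₀ = (u : R) • z)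
    (𝔭 : PrimeSpectrum R) :
    lengthAt R (H ⧸ R ∙ z₀) 𝔭 = lengthAt R (H ⧸ R ∙ z) 𝔭 :=
  lengthAt_eq_of_linearEquiv (Submodule.quotEquivOfEq _ _ (span_singleton_eq_of_eq_units_smul h)) 𝔭

/-- **Cancellation, both directions**: along `a • z₀ = b • z`, with `length_𝔭 (R/(b))` and `length_𝔭 (H/R∙z)` finite,
`length_𝔭 (H/R∙z₀) = length_𝔭 (H/R∙z) ↔ length_𝔭 (R/(a)) = length_𝔭 (R/(b))`. [cite: Washington1997, §13.2] -/
theorem lengthAt_quotient_span_eq_iff_of_smul_eq_smul {z₀ z : H} (hz₀ : ∀ r : R, r • z₀ = 0 → r = 0)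
    (hz : ∀ r : R, r • z = 0 → r = 0) {a b : R} (h : a • z₀ = b • z) (𝔭 : PrimeSpectrum R)
    (hfinb : lengthAt R (R ⧸ Ideal.span {b}) 𝔭 ≠ ⊤) (hfinz : lengthAt R (H ⧸ R ∙ z) 𝔭 ≠ ⊤) :
    lengthAt R (H ⧸ R ∙ z₀) 𝔭 = lengthAt R (H ⧸ R ∙ z) 𝔭 ↔
      lengthAt R (R ⧸ Ideal.span {a}) 𝔭 = lengthAt R (R ⧸ Ideal.span {b}) 𝔭 := by
  have key := lengthAt_add_eq_of_smul_eq_smul hz₀ hz h 𝔭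
  refine ⟨fun hzz => ?_, fun hab => ?_⟩
  · rw [hzz] at key
    exact (WithTop.add_right_inj hfinz).mp key
  · rw [hab, add_comm _ (lengthAt R (H ⧸ R ∙ z₀) 𝔭), add_comm _ (lengthAt R (H ⧸ R ∙ z) 𝔭)] at key
    exact (WithTop.add_right_inj hfinb).mp key

end Generic

/-! ## §2 `Λ = ℤ_p⟦T⟧` at the prime `(p)`: the `μ`-content of a non-zero power series -/

section Mu

variable {p : ℕ} [Fact p.Prime]

/-- `C(p) ∈ 𝔮` when `𝔮 = (p)`. [cite: Washington1997, §13.2] -/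
theorem C_mem_of_eq_augIdealP (𝔮 : PrimeSpectrum (IwasawaAlgebra p)) (h𝔮 : 𝔮.asIdeal = augIdealP p) :
    (PowerSeries.C (p : ℤ_[p]) : IwasawaAlgebra p) ∈ 𝔮.asIdeal := by
  rw [h𝔮]
  exact Ideal.mem_span_singleton_self _

/-- Membership in `(p)` is divisibility by `C(p)`. [cite: Washington1997, §13.1] -/
theorem mem_augIdealP_iff_C_dvd (G : IwasawaAlgebra p) :
    G ∈ augIdealP p ↔ (PowerSeries.C (p : ℤ_[p]) : IwasawaAlgebra p) ∣ G :=
  Ideal.mem_span_singleton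

/-- **`μ`-factorisation**: every non-zero `F ∈ Λ` is `C(p)^m · F′` with `F′ ∉ (p)` (`Λ` is a Noetherian domain, `C(p)` is
prime). [cite: Washington1997, §13.2] -/
theorem exists_eq_C_pow_mul_not_mem {F : IwasawaAlgebra p} (hF : F ≠ 0) :
    ∃ (m : ℕ) (F' : IwasawaAlgebra p), F' ∉ augIdealP p ∧ F = PowerSeries.C (p : ℤ_[p]) ^ m * F' := by
  obtain ⟨m, F', hF', rfl⟩ := WfDvdMonoid.max_power_factor hF (prime_C p).irreducible
  exact ⟨m, F', fun h => hF' ((mem_augIdealP_iff_C_dvd F').mp h), rfl⟩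

/-- **`length_(p) (Λ ⧸ (C(p)^m · F′)) = m` for `F′ ∉ (p)`** — the local length at `(p)` of a cyclic module is the
`μ`-content of its generator. [cite: Washington1997, §13.2] -/
theorem lengthAt_quotient_span_C_pow_mul_of_not_mem (m : ℕ) {F' : IwasawaAlgebra p} (hF' : F' ∉ augIdealP p)
    (𝔮 : PrimeSpectrum (IwasawaAlgebra p)) (h𝔮 : 𝔮.asIdeal = augIdealP p) :
    lengthAt (IwasawaAlgebra p)
        (IwasawaAlgebra p ⧸ Ideal.span {PowerSeries.C (p : ℤ_[p]) ^ m * F'}) 𝔮 = m := by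
  have hC : (PowerSeries.C (p : ℤ_[p]) : IwasawaAlgebra p) ^ m ≠ 0 := pow_ne_zero m (prime_C p).ne_zero
  have hht : 𝔮.asIdeal.height = 1 := by rw [h𝔮]; exact height_augIdealP_holds p
  have hF'𝔮 : ¬ Ideal.span {F'} ≤ 𝔮.asIdeal := by
    rw [Ideal.span_singleton_le_iff_mem, h𝔮]; exact hF'
  rw [lengthAt_quotient_span_singleton_mul F' hC 𝔮, ← map_pow, lengthAt_quotient_C_pow m 𝔮 hht,
    if_pos (C_mem_of_eq_augIdealP 𝔮 h𝔮), lengthAt_quotient_eq_zero_of_not_le hF'𝔮, add_zero]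
  simp

/-- **Finiteness**: `length_(p) (Λ ⧸ (F)) < ∞` for `F ≠ 0`. [cite: Washington1997, §13.2] -/
theorem lengthAt_quotient_span_ne_top_of_ne_zero {F : IwasawaAlgebra p} (hF : F ≠ 0)
    (𝔮 : PrimeSpectrum (IwasawaAlgebra p)) (h𝔮 : 𝔮.asIdeal = augIdealP p) :
    lengthAt (IwasawaAlgebra p) (IwasawaAlgebra p ⧸ Ideal.span {F}) 𝔮 ≠ ⊤ := by
  obtain ⟨m, F', hF', rfl⟩ := exists_eq_C_pow_mul_not_mem hF
  rw [lengthAt_quotient_span_C_pow_mul_of_not_mem m hF' 𝔮 h𝔮]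
  exact WithTop.natCast_ne_top m

end Mu

/-! ## §3 On the objects of stub 2b: collinear classes in `𝐇¹_Γ(T_pW)` (`Kato2004.IwasawaH1Data`) -/

section H1

variable {W : WeierstrassCurve ℚ} [W.IsElliptic] {p : ℕ} [Fact p.Prime]
  [ContinuousSMul ℤ_[p] (W.tateModule p)] {K : ZpExtension ℚ p} {γ : absoluteGaloisGroup ℚ}
  (I : IwasawaH1Data W p K γ)

/-- A non-zero element of the torsion-free `Λ`-module `𝐇¹_Γ(T_pW)` (`Kato2004.IwasawaH1Data.isTorsionFree`, `γ` a
topological generator) has trivial annihilator. [cite: Kato2004Asterisque, Thm. 12.4 (2) (p. 221)] -/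
theorem smul_eq_zero_imp_of_ne_zero (hγ : K.IsTopGenerator γ) {z : I.H} (hz : z ≠ 0) (r : IwasawaAlgebra p)
    (h : r • z = 0) : r = 0 := by
  haveI := I.isTorsionFree hγ
  exact (smul_eq_zero_iff_left hz).mp h

/-- **ZC, unit form ⟹ equal local lengths everywhere**: `z₀ = u • z` with `u ∈ Λˣ` gives
`length_𝔮 (𝐇¹_Γ ⧸ Λ∙z₀) = length_𝔮 (𝐇¹_Γ ⧸ Λ∙z)` at EVERY prime `𝔮` of `Λ` (the sufficient condition «`∃ u : Λˣ, z₀ = u • P.z`»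
of hand -3's census, made kernel; nothing about admissibility is used). [cite: Kato2004Asterisque, Conj. 12.10 (p. 224)] -/
theorem lengthAt_quotient_span_eq_of_eq_units_smul_H {z₀ z : I.H} {u : (IwasawaAlgebra p)ˣ}
    (h : z₀ = (u : IwasawaAlgebra p) • z) (𝔮 : PrimeSpectrum (IwasawaAlgebra p)) :
    lengthAt (IwasawaAlgebra p) (I.H ⧸ (IwasawaAlgebra p) ∙ z₀) 𝔮 =
      lengthAt (IwasawaAlgebra p) (I.H ⧸ (IwasawaAlgebra p) ∙ z) 𝔮 :=
  lengthAt_quotient_span_eq_of_eq_units_smul h 𝔮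

/-- **The collinearity identity in `𝐇¹_Γ(T_pW)`**: for non-zero `z₀, z ∈ I.H` with `F • z₀ = G • z`,
`length_𝔮 (Λ/(F)) + length_𝔮 (𝐇¹_Γ ⧸ Λ∙z₀) = length_𝔮 (Λ/(G)) + length_𝔮 (𝐇¹_Γ ⧸ Λ∙z)` at every prime `𝔮` of `Λ`.
[cite: Kato2004Asterisque, Thm. 12.4 (2) (p. 221)] [cite: Washington1997, §13.2] -/
theorem lengthAt_add_eq_of_collinear (hγ : K.IsTopGenerator γ) {z₀ z : I.H} (hz₀ : z₀ ≠ 0) (hz : z ≠ 0)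
    {F G : IwasawaAlgebra p} (h : F • z₀ = G • z) (𝔮 : PrimeSpectrum (IwasawaAlgebra p)) :
    lengthAt (IwasawaAlgebra p) (IwasawaAlgebra p ⧸ Ideal.span {F}) 𝔮 +
        lengthAt (IwasawaAlgebra p) (I.H ⧸ (IwasawaAlgebra p) ∙ z₀) 𝔮 =
      lengthAt (IwasawaAlgebra p) (IwasawaAlgebra p ⧸ Ideal.span {G}) 𝔮 +
        lengthAt (IwasawaAlgebra p) (I.H ⧸ (IwasawaAlgebra p) ∙ z) 𝔮 :=
  lengthAt_add_eq_of_smul_eq_smul (smul_eq_zero_imp_of_ne_zero I hγ hz₀) (smul_eq_zero_imp_of_ne_zero I hγ hz) h 𝔮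

/-- In a collinearity `F • z₀ = G • z` between non-zero elements of `𝐇¹_Γ`, `F ≠ 0 ↔ G ≠ 0`.
[cite: Kato2004Asterisque, Thm. 12.4 (2) (p. 221)] -/
theorem ne_zero_iff_ne_zero_of_collinear (hγ : K.IsTopGenerator γ) {z₀ z : I.H} (hz₀ : z₀ ≠ 0) (hz : z ≠ 0)
    {F G : IwasawaAlgebra p} (h : F • z₀ = G • z) : F ≠ 0 ↔ G ≠ 0 := by
  constructor
  · intro hF hG
    rw [hG, zero_smul] at h
    exact hF (smul_eq_zero_imp_of_ne_zero I hγ hz₀ F h)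
  · intro hG hF
    rw [hF, zero_smul] at h
    exact hG (smul_eq_zero_imp_of_ne_zero I hγ hz G h.symm)

/-- **The `μ`-reading of a collinearity**: for non-zero `z₀, z ∈ 𝐇¹_Γ(T_pW)` with
`(C(p)^m · F′) • z₀ = (C(p)^n · G′) • z`, `F′, G′ ∉ (p)`, at `𝔮 = (p)`:
`m + length_(p) (𝐇¹_Γ ⧸ Λ∙z₀) = n + length_(p) (𝐇¹_Γ ⧸ Λ∙z)`. [cite: Washington1997, §13.2]
[cite: Kato2004Asterisque, Thm. 12.4 (2) (p. 221), Conj. 12.10 (p. 224)] -/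
theorem natCast_add_lengthAt_eq_of_collinear (hγ : K.IsTopGenerator γ) {z₀ z : I.H} (hz₀ : z₀ ≠ 0)
    (hz : z ≠ 0) {m n : ℕ} {F' G' : IwasawaAlgebra p} (hF' : F' ∉ augIdealP p) (hG' : G' ∉ augIdealP p)
    (h : (PowerSeries.C (p : ℤ_[p]) ^ m * F') • z₀ = (PowerSeries.C (p : ℤ_[p]) ^ n * G') • z)
    (𝔮 : PrimeSpectrum (IwasawaAlgebra p)) (h𝔮 : 𝔮.asIdeal = augIdealP p) :
    (m : ℕ∞) + lengthAt (IwasawaAlgebra p) (I.H ⧸ (IwasawaAlgebra p) ∙ z₀) 𝔮 =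
      (n : ℕ∞) + lengthAt (IwasawaAlgebra p) (I.H ⧸ (IwasawaAlgebra p) ∙ z) 𝔮 := by
  have key := lengthAt_add_eq_of_collinear I hγ hz₀ hz h 𝔮
  rwa [lengthAt_quotient_span_C_pow_mul_of_not_mem m hF' 𝔮 h𝔮,
    lengthAt_quotient_span_C_pow_mul_of_not_mem n hG' 𝔮 h𝔮] at key

/-- **«ZC-μ» ⟸ equal `μ`-contents**: in the situation of `natCast_add_lengthAt_eq_of_collinear`, `m = n` gives
`length_(p) (𝐇¹_Γ ⧸ Λ∙z₀) = length_(p) (𝐇¹_Γ ⧸ Λ∙z)` (no finiteness needed). [cite: Washington1997, §13.2]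
[cite: BurungaleTian2026, Rem. 2.7 (p. 5)] -/
theorem lengthAt_quotient_span_eq_of_collinear_of_eq (hγ : K.IsTopGenerator γ) {z₀ z : I.H} (hz₀ : z₀ ≠ 0)
    (hz : z ≠ 0) {m n : ℕ} {F' G' : IwasawaAlgebra p} (hF' : F' ∉ augIdealP p) (hG' : G' ∉ augIdealP p)
    (h : (PowerSeries.C (p : ℤ_[p]) ^ m * F') • z₀ = (PowerSeries.C (p : ℤ_[p]) ^ n * G') • z)
    (hmn : m = n) (𝔮 : PrimeSpectrum (IwasawaAlgebra p)) (h𝔮 : 𝔮.asIdeal = augIdealP p) :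
    lengthAt (IwasawaAlgebra p) (I.H ⧸ (IwasawaAlgebra p) ∙ z₀) 𝔮 =
      lengthAt (IwasawaAlgebra p) (I.H ⧸ (IwasawaAlgebra p) ∙ z) 𝔮 := by
  have key := natCast_add_lengthAt_eq_of_collinear I hγ hz₀ hz hF' hG' h 𝔮 h𝔮
  rw [hmn] at key
  exact (WithTop.add_left_inj (WithTop.natCast_ne_top n)).mp key

/-- **«ZC-μ» ⟺ equal `μ`-contents** when `length_(p) (𝐇¹_Γ ⧸ Λ∙z)` is finite: in the situation of
`natCast_add_lengthAt_eq_of_collinear`,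
`length_(p) (𝐇¹_Γ ⧸ Λ∙z₀) = length_(p) (𝐇¹_Γ ⧸ Λ∙z) ↔ m = n` — the residual of stub 2b at the pair `(z₀, z)` is ONE
integer equality read off ANY collinearity relation. [cite: Washington1997, §13.2] [cite: BurungaleTian2026, Rem. 2.7 (p. 5)]
[cite: Kato2004Asterisque, Conj. 12.10 (p. 224)] -/
theorem lengthAt_quotient_span_eq_iff_of_collinear (hγ : K.IsTopGenerator γ) {z₀ z : I.H} (hz₀ : z₀ ≠ 0)
    (hz : z ≠ 0) {m n : ℕ} {F' G' : IwasawaAlgebra p} (hF' : F' ∉ augIdealP p) (hG' : G' ∉ augIdealP p)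
    (h : (PowerSeries.C (p : ℤ_[p]) ^ m * F') • z₀ = (PowerSeries.C (p : ℤ_[p]) ^ n * G') • z)
    (𝔮 : PrimeSpectrum (IwasawaAlgebra p)) (h𝔮 : 𝔮.asIdeal = augIdealP p)
    (hfin : lengthAt (IwasawaAlgebra p) (I.H ⧸ (IwasawaAlgebra p) ∙ z) 𝔮 ≠ ⊤) :
    lengthAt (IwasawaAlgebra p) (I.H ⧸ (IwasawaAlgebra p) ∙ z₀) 𝔮 =
        lengthAt (IwasawaAlgebra p) (I.H ⧸ (IwasawaAlgebra p) ∙ z) 𝔮 ↔ m = n := by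
  refine ⟨fun hzz => ?_, fun hmn => lengthAt_quotient_span_eq_of_collinear_of_eq I hγ hz₀ hz hF' hG' h hmn 𝔮 h𝔮⟩
  have key := natCast_add_lengthAt_eq_of_collinear I hγ hz₀ hz hF' hG' h 𝔮 h𝔮
  rw [hzz] at key
  exact ENat.coe_inj.mp ((WithTop.add_right_inj hfin).mp key)

/-- **Every collinearity has a `μ`-reading**: `F • z₀ = G • z` with `F ≠ 0` between non-zero elements of `𝐇¹_Γ`
factors as `(C(p)^m F′) • z₀ = (C(p)^n G′) • z` with `F′, G′ ∉ (p)` (and `G ≠ 0`).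
[cite: Washington1997, §13.2] [cite: Kato2004Asterisque, Thm. 12.4 (2) (p. 221)] -/
theorem exists_mu_reading_of_collinear (hγ : K.IsTopGenerator γ) {z₀ z : I.H} (hz₀ : z₀ ≠ 0) (hz : z ≠ 0)
    {F G : IwasawaAlgebra p} (hF : F ≠ 0) (h : F • z₀ = G • z) :
    ∃ (m n : ℕ) (F' G' : IwasawaAlgebra p), F' ∉ augIdealP p ∧ G' ∉ augIdealP p ∧
      F = PowerSeries.C (p : ℤ_[p]) ^ m * F' ∧ G = PowerSeries.C (p : ℤ_[p]) ^ n * G' ∧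
      (PowerSeries.C (p : ℤ_[p]) ^ m * F') • z₀ = (PowerSeries.C (p : ℤ_[p]) ^ n * G') • z := by
  have hG : G ≠ 0 := (ne_zero_iff_ne_zero_of_collinear I hγ hz₀ hz h).mp hF
  obtain ⟨m, F', hF', rfl⟩ := exists_eq_C_pow_mul_not_mem hF
  obtain ⟨n, G', hG', rfl⟩ := exists_eq_C_pow_mul_not_mem hG
  exact ⟨m, n, F', G', hF', hG', rfl, rfl, h⟩

/-- **Existence of a collinearity with both coefficients non-zero** for any two non-zero elements of `𝐇¹_Γ(T_pW)` when
`rank_Λ 𝐇¹_Γ = 1` (Kato Thm. 12.4 (2); on the rows of crux 19223 a tree theorem from Mordell–Weil rank one and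
`Ш[p^∞]` finite, `IwasawaH1Data.rank_eq_one_of_rank_integralH1_le_one`) — via the tree's
`PerrinRiouUnit.exists_primitive_collinear`. [cite: Kato2004Asterisque, Thm. 12.4 (2) (p. 221) and §13.9 (p. 230)] -/
theorem exists_collinear_ne_zero (hγ : K.IsTopGenerator γ) (hrank : Module.rank (IwasawaAlgebra p) I.H = 1)
    {z₀ z : I.H} (hz₀ : z₀ ≠ 0) (hz : z ≠ 0) :
    ∃ F G : IwasawaAlgebra p, F ≠ 0 ∧ G ≠ 0 ∧ F • z₀ = G • z := by
  haveI := I.isTorsionFree hγ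
  obtain ⟨F, G, hFG, hprim⟩ :=
    Summit.BirchSwinnertonDyer.Rank1Residual.Additive.PerrinRiouUnit.exists_primitive_collinear hrank z₀ z
  have hiff := ne_zero_iff_ne_zero_of_collinear I hγ hz₀ hz hFG
  rcases hprim with hF0 | hG0
  · have hF : F ≠ 0 := fun h => hF0 (by rw [h, map_zero])
    exact ⟨F, G, hF, hiff.mp hF, hFG⟩
  · have hG : G ≠ 0 := fun h => hG0 (by rw [h, map_zero])
    exact ⟨F, G, hiff.mpr hG, hG, hFG⟩

/-- **The `μ`-defect of a pair.**  Under `rank_Λ 𝐇¹_Γ = 1`, for non-zero `z₀, z ∈ 𝐇¹_Γ(T_pW)` there are `m n : ℕ` and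
`F′, G′ ∉ (p)` with `(C(p)^m F′) • z₀ = (C(p)^n G′) • z`, and for ANY such reading
`m + length_(p) (𝐇¹_Γ ⧸ Λ∙z₀) = n + length_(p) (𝐇¹_Γ ⧸ Λ∙z)`: the integer `m − n` is the `μ`-part of the «valuation of the
ratio `z₀/z`», and «ZC-μ» for the pair says `m = n`. [cite: Washington1997, §13.2]
[cite: Kato2004Asterisque, Thm. 12.4 (2) (p. 221), Conj. 12.10 (p. 224)] [cite: BurungaleTian2026, Rem. 2.7 (p. 5)] -/
theorem exists_mu_reading (hγ : K.IsTopGenerator γ) (hrank : Module.rank (IwasawaAlgebra p) I.H = 1)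
    {z₀ z : I.H} (hz₀ : z₀ ≠ 0) (hz : z ≠ 0) (𝔮 : PrimeSpectrum (IwasawaAlgebra p))
    (h𝔮 : 𝔮.asIdeal = augIdealP p) :
    ∃ (m n : ℕ) (F' G' : IwasawaAlgebra p), F' ∉ augIdealP p ∧ G' ∉ augIdealP p ∧
      (PowerSeries.C (p : ℤ_[p]) ^ m * F') • z₀ = (PowerSeries.C (p : ℤ_[p]) ^ n * G') • z ∧
      (m : ℕ∞) + lengthAt (IwasawaAlgebra p) (I.H ⧸ (IwasawaAlgebra p) ∙ z₀) 𝔮 =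
        (n : ℕ∞) + lengthAt (IwasawaAlgebra p) (I.H ⧸ (IwasawaAlgebra p) ∙ z) 𝔮 := by
  obtain ⟨F, G, hF, -, hFG⟩ := exists_collinear_ne_zero I hγ hrank hz₀ hz
  obtain ⟨m, n, F', G', hF', hG', -, -, h⟩ := exists_mu_reading_of_collinear I hγ hz₀ hz hF hFG
  exact ⟨m, n, F', G', hF', hG', h, natCast_add_lengthAt_eq_of_collinear I hγ hz₀ hz hF' hG' h 𝔮 h𝔮⟩

end H1

end Summit.BirchSwinnertonDyer.BirchSwinnertonDyer.Theorems.CccOneCollinearMu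

end
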